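import Summits.QuantumFields.YangMills.Theorems.BalabanUVNodesN07Row84OfEq81AtRecord
import Summits.QuantumFields.YangMills.Theorems.BalabanUVNodesN07JOfRecordBoundOfThm1Class
import Summits.QuantumFields.YangMills.Theorems.BalabanUVNodesN07SectBExpansionAtObjects
import Literature.MathematicalPhysics.QuantumFieldTheory.Balaban1983to89.B9Eq3117HessOpGaugeMode
import Literature.MathematicalPhysics.QuantumFieldTheory.Balaban1983to89.B9Eq310DeltaPrimeJunction
import Literature.MathematicalPhysics.QuantumFieldTheory.Balaban1983to89.B11Eq98CurrentSlot
import HarnessLib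

/-!
# N07 — THE TERMS OF [15] (26) AT THE RECORD, IN def-Y's `L²` LETTERS: pv27's tautological expansion `A(U₁U₀) = A(U₀) + ⟨A,J⟩ + ½⟨A,ΔA⟩ + V₀(A)` (✓`eq26`, any lattice)
# read at lit's letters `Tsh ∕ Ucur (unitsOfRecord F N U₀)` of the record — the action IS `wilsonAction4` (reindexing along ✓`siteToLit`), `⟨A,J⟩` IS `pair27 τRec J_rec`
# (✓`pair27_Jcur`), `⟨A,ΔA⟩` IS `⟪ιY, hessOpOfRecord ιY⟫` (lit ✓`tpair_hessOp_eq` + ✓`hessForm_self_eq_hessPair`), `V₀` IS the fourth term of `V80Z` VERBATIM — so that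
# print's (74) at the record rests on ONE displayed chart letter (S1 of the spec): `Ucur (unitsOfRecord (chart field)) = prodCfg (Ucur (unitsOfRecord U₀)) η Ŷ`

Cell `pub-ymgap`, seat `pub-ymgap-dag-n07-w3` (g29, WIDTH SEAT 3 on N07 [B11] = [15]); helper file keyed `--kind proof --supports stmt-QuantumFields-27238 --as helper` (K0ᴬ road);
count-neutral.  INTENT-7 of the seat; executes steps (S2), (S3), (S5) of the seat's spec `EQ81-AT-RECORD-SPEC.g29.md` (evidence on ⟨27238⟩).

## What is here

* §1 (generic, pv27's abstract lattice) `τ`-SCALING: `wil_smul`, `action_smul`, `bondPair_smul`, `deltaPrime_smul`, `hessPair_smul`, `V0_smul` — every functional of (26) is linear in the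
  trace functional `τ` (so `τ_N = N⁻¹·tr` and def-Y's `tauRec = tr` differ by the scalar `N⁻¹` throughout).
* §2 (generic) REINDEXING along a site equivalence intertwining the shifts (g25's kit ✓`plaqU_reindex`): `action_reindex`.
* §3 (record) ★ `action_lit_eq_wilsonAction4` — pv27's action at lit's letters of the record IS the tree's Wilson action: `action Tsh η 4 τ_N (Ucur (unitsOfRecord F N U)) = wilsonAction4 U`
  (n07-w1 ✓`action_torusT_cfgGL_eq_wilsonAction4` transported by §2 with ✓`siteToLit_torusT`, ✓`ucur_unitsOfRecord_siteToLit`); `action_lit_tauRec` (`τ = tr`: `= N·A(U)`).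
* §4 (record) THE DICTIONARY OF THE THREE TERMS: ★ `pair27_JOfRecordAtBg_eq_bondPair` (`⟨Ŷ, J⟩`), ★★ `inner_iota_hessOpOfRecord_eq_hessForm` ∕ `inner_iota_hessOpOfRecord_self_eq_hessPair`
  (`⟪ιY, Δ(U₀) ιY⟫_ℂ = hessPair Tsh (Ucur …) η d tr Ŷ` for Hermitian-presented `Y` — lit ✓`inner_eq_tpair_starW`, ✓`tpair_hessOp_eq` with its MODEL letters `hτ₂ hφ hU hc₀` DISCHARGED at the
  record, ✓`toAlg_starW`, ✓`hessForm_self_eq_hessPair`).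
* §5 ★★★ `wilsonAction4_eq26_atRecordLetters` — (26)∕(74)-WITHOUT-`π` AT THE RECORD: for every SU-field `U` whose lit transporters are the `exp`-perturbation of the background's by a
  Hermitian-presented jet `Y` (the displayed chart letter `hchart`), `A(U) = A(U₀) + N⁻¹·ℜ( pair27 τRec J_rec Ŷ + ½⟪ιY, hessOpOfRecord ιY⟫ + V₀(Tsh, Ucur(U₀), η, 4, tr)(curL Ŷ) )`.

## Honest labels

Bookkeeping over constructed letters; no estimate.  What remains for (74)∕(81) at the record after this file: the chart letter `hchart` for def-Y's `S.chartLin T♭` (spec (S1): the value of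
`unitsOfRecord` at the chart field vs `prodCfg`; g28 ✓`coeField_chartLin_eq_expOver` is the ingredient), and the (78)–(79) regrouping `Δ(U₀) ↦ π†(Δ(U₀)+Δ⁽²⁾)π` on the Landau slice with
def-Y's `Delta2Tok` (spec (S4); lit ✓`B11Eq81Expansion.eq81` abstract).  Nothing of Bałaban's estimates proved; K0ᴬ ⟨27238⟩ NOT closed; N07 NOT discharged; COUNT∕K UNMOVED; R4 is the
conditional finite-𝕋⁴ rung `BalabanLadder.UV` only; finite torus at fixed `ε` — nothing continuum ∕ OS ∕ Clay.  **The Yang–Mills mass gap is NOT proved by any of this.**  No `sorry`,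
no `def`, no `instance ∕ notation ∕ set_option`; standard axioms.
[cite: Balaban1985Variational, (26)–(27) p.282, (74) p.289; Balaban1985BackgroundPropagators, (3.1) p.390, (3.10)–(3.11) p.392]
-/

noncomputable section

open Set Finset
open scoped Matrix Matrix.Norms.L2Operator InnerProductSpace ComplexConjugate

namespace Summit.QuantumFields.YangMills.Theorems.N07Eq26TermsAtRecordLetters

open Literature.MathematicalPhysics.QuantumFieldTheory.Balaban1983to89
open Literature.MathematicalPhysics.QuantumFieldTheory.Balaban1983to89.T4Continuum (T4Family)
open Literature.MathematicalPhysics.QuantumFieldTheory.Balaban1983to89.Node00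
open B9Eq37Insertion (wil)
open B9Eq39Adjoint (plaqU bondPair deltaPrime hessPair action prodCfg J posPlaq sum_posPlaq)
open B11Eq26ActionExpansion (V0)
open B9Eq311L2Pairing (WL2)
open B9Eq311TracePairing (starW tpair inner_eq_tpair_starW)
open B9Eq310HessianOperator (toAlg hessOp)
open B9Eq310DeltaPrime (hessForm)
open B9Eq310DeltaPrimeJunction (hessForm_self_eq_hessPair)
open B9Eq3117HessOpGaugeMode (tpair_hessOp_eq)
open B9Eq3119DeltaPiCarrier (toAlg_starW)
open B11Eq103H1Complex (SiteL2K BondL2K funEquiv)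
open B11Eq111FrakG (nabla115)
open B11Eq115Space (NegSup JetSup)
open B11Eq90Transpose (pair27)
open B11Eq90V0primeCurrent (Tsh Ucur curL curL_apply)
open B11Eq98CurrentSlot (Jcur pair27_Jcur)
open B9TorusCalculus (torusT)
open B12Eq18Current (dirForm)
open Summit.QuantumFields.YangMills.Theorems.N07JOfRecordBoundOfThm1Class (plaqU_reindex siteToLit_torusT ucur_unitsOfRecord_siteToLit)
open Summit.QuantumFields.YangMills.BalabanUVNodes.N07SectBExpansionAtObjects (action_torusT_cfgGL_eq_wilsonAction4)

/-! ## §1  `τ`-scaling of the functionals of (26) -/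

section Smul

variable {𝔸 : Type*} [NormedRing 𝔸] [NormedAlgebra ℂ 𝔸] [CompleteSpace 𝔸]
  {S : Type*} [Fintype S] {ι : Type*} [Fintype ι] [LinearOrder ι] (T : ι → Equiv.Perm S) (U : ι → S → 𝔸ˣ)

omit [CompleteSpace 𝔸] in
/-- `wil (c•τ) W = c · wil τ W`. [cite: Balaban1985BackgroundPropagators, (3.1) p.390 (bookkeeping)] -/
theorem wil_smul (c : ℂ) (τ : 𝔸 →ₗ[ℂ] ℂ) (W : 𝔸ˣ) : wil (c • τ) W = c * wil τ W := by
  simp only [wil, LinearMap.smul_apply, smul_eq_mul]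
  ring

omit [CompleteSpace 𝔸] in
/-- `A_{c•τ} = c · A_τ`. [cite: Balaban1985BackgroundPropagators, (3.1) p.390 (bookkeeping)] -/
theorem action_smul (c : ℂ) (η : ℝ) (d : ℕ) (τ : 𝔸 →ₗ[ℂ] ℂ) (V : ι → S → 𝔸ˣ) :
    action T η d (c • τ) V = c * action T η d τ V := by
  simp only [action, wil_smul, Finset.mul_sum]
  exact Finset.sum_congr rfl fun _ _ => by ring

omit [CompleteSpace 𝔸] [LinearOrder ι] in
/-- `⟨A, E⟩_{c•τ} = c · ⟨A, E⟩_τ`. [cite: Balaban1985BackgroundPropagators, (3.11) p.392 (bookkeeping)] -/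
theorem bondPair_smul (c : ℂ) (η : ℝ) (d : ℕ) (τ : 𝔸 →ₗ[ℂ] ℂ) (A E : ι → S → 𝔸) :
    bondPair η d (c • τ) A E = c * bondPair η d τ A E := by
  simp only [bondPair, LinearMap.smul_apply, smul_eq_mul, Finset.mul_sum]
  exact Finset.sum_congr rfl fun _ _ => Finset.sum_congr rfl fun _ _ => by ring

omit [CompleteSpace 𝔸] in
/-- `⟨A, Δ′A⟩_{c•τ} = c · ⟨A, Δ′A⟩_τ`. [cite: Balaban1985BackgroundPropagators, (3.12) p.392 (bookkeeping)] -/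
theorem deltaPrime_smul (c : ℂ) (η : ℝ) (d : ℕ) (τ : 𝔸 →ₗ[ℂ] ℂ) (A : ι → S → 𝔸) :
    deltaPrime T U η d (c • τ) A = c * deltaPrime T U η d τ A := by
  simp only [deltaPrime, LinearMap.smul_apply, smul_eq_mul, Finset.mul_sum]
  exact Finset.sum_congr rfl fun _ _ => by ring

omit [CompleteSpace 𝔸] in
/-- `⟨A, ΔA⟩_{c•τ} = c · ⟨A, ΔA⟩_τ`. [cite: Balaban1985BackgroundPropagators, (3.10) p.392 (bookkeeping)] -/
theorem hessPair_smul (c : ℂ) (η : ℝ) (d : ℕ) (τ : 𝔸 →ₗ[ℂ] ℂ) (A : ι → S → 𝔸) :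
    hessPair T U η d (c • τ) A = c * hessPair T U η d τ A := by
  rw [hessPair, hessPair, bondPair_smul, deltaPrime_smul]
  ring

/-- `V₀,_{c•τ} = c · V₀,_τ`. [cite: Balaban1985Variational, (26) p.282 (bookkeeping)] -/
theorem V0_smul (c : ℂ) (η : ℝ) (d : ℕ) (τ : 𝔸 →ₗ[ℂ] ℂ) (A : ι → S → 𝔸) :
    V0 T U η d (c • τ) A = c * V0 T U η d τ A := by
  rw [V0, V0, action_smul, action_smul, bondPair_smul, hessPair_smul]
  ring

end Smul

/-! ## §2  Reindexing the action along a site equivalence -/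

section Reindex

variable {𝔸 : Type*} [NormedRing 𝔸] [NormedAlgebra ℂ 𝔸] [CompleteSpace 𝔸] {S S' ι : Type*} [Fintype S] [Fintype S'] [Fintype ι] [LinearOrder ι]
  (e : S ≃ S') (T : ι → Equiv.Perm S) (T' : ι → Equiv.Perm S') (U : ι → S → 𝔸ˣ) (U' : ι → S' → 𝔸ˣ)
  (hT : ∀ (μ : ι) (x : S), e (T μ x) = T' μ (e x)) (hU : ∀ (μ : ι) (x : S), U' μ (e x) = U μ x)

omit [CompleteSpace 𝔸] in
include hT hU in
/-- **The action commutes with reindexing**: `A_{T′,U′} = A_{T,U}` when `e` intertwines the shifts and the transporters (✓`plaqU_reindex`).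
[cite: Balaban1985BackgroundPropagators, (3.1) p.390] -/
theorem action_reindex (η : ℝ) (d : ℕ) (τ : 𝔸 →ₗ[ℂ] ℂ) : action T' η d τ U' = action T η d τ U := by
  simp only [action]
  rw [sum_posPlaq (fun x μ ν => (η : ℂ) ^ (d - 4) * wil τ (plaqU T' U' μ ν x)), sum_posPlaq (fun x μ ν => (η : ℂ) ^ (d - 4) * wil τ (plaqU T U μ ν x)),
    ← e.sum_comp]
  simp only [plaqU_reindex e T T' U U' hT hU]

end Reindex


/-! ## §3  The action of record at lit's letters -/

section Record

variable (F : T4Family) (N : ℕ) [NeZero N] {K : ℕ} (k : ℕ) (Ω : ℕ → Set (Site (F.P K) 0)) (U₀ : GaugeField (F.P K) 0 (SU N))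

omit [NeZero N] in
/-- `τ`-letters: def-Y's continuous trace read as a linear map IS `tauRec = tr`. [cite: Balaban1985BackgroundPropagators, (3.11) p.392 (bookkeeping)] -/
theorem coe_tauRecCLM : (tauRecCLM N : Matrix (Fin N) (Fin N) ℂ →ₗ[ℂ] ℂ) = tauRec N := rfl

omit [NeZero N] in
/-- `τ_N = N⁻¹ • tr`. [cite: Balaban1985BackgroundPropagators, (3.1) p.390 (bookkeeping)] -/
theorem trN_eq_smul_tauRec : ((N : ℂ)⁻¹ • Matrix.traceLinearMap (Fin N) ℂ ℂ) = (N : ℂ)⁻¹ • tauRec N := rfl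

/-- ★ **pv27's ACTION AT lit's LETTERS OF THE RECORD IS THE TREE's WILSON ACTION**: `action Tsh η d τ_N (Ucur (unitsOfRecord F N U)) = A^η(U)` — n07-w1's
✓`action_torusT_cfgGL_eq_wilsonAction4` transported along ✓`siteToLit` (§2, ✓`siteToLit_torusT`, ✓`ucur_unitsOfRecord_siteToLit`). [cite: Balaban1985BackgroundPropagators, (3.1) p.390; Balaban1985Variational, (26) p.282] -/
theorem action_lit_eq_wilsonAction4 (η : ℝ) (U : GaugeField (F.P K) 0 (SU N)) :
    action Tsh η (F.P K).d ((N : ℂ)⁻¹ • Matrix.traceLinearMap (Fin N) ℂ ℂ) (Ucur (unitsOfRecord F N U)) = ((wilsonAction4 U : ℝ) : ℂ) := by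
  rw [action_reindex (siteToLit (F.P K) 0) (torusT (F.P K) 0) Tsh (dirForm (cfgGL N U)) (Ucur (unitsOfRecord F N U))
    (siteToLit_torusT F) (ucur_unitsOfRecord_siteToLit F N U)]
  exact action_torusT_cfgGL_eq_wilsonAction4 η U

/-- The same with def-Y's `tauRec = tr`: `action Tsh η d tr (Ucur (unitsOfRecord F N U)) = N · A^η(U)`. [cite: Balaban1985BackgroundPropagators, (3.1) p.390 (bookkeeping)] -/
theorem action_lit_tauRec (η : ℝ) (U : GaugeField (F.P K) 0 (SU N)) :
    action Tsh η (F.P K).d (tauRec N) (Ucur (unitsOfRecord F N U)) = (N : ℂ) * ((wilsonAction4 U : ℝ) : ℂ) := by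
  have hN : (N : ℂ) ≠ 0 := Nat.cast_ne_zero.2 (NeZero.ne N)
  have h := action_lit_eq_wilsonAction4 F N η U
  rw [trN_eq_smul_tauRec, action_smul] at h
  rw [← h, ← mul_assoc, mul_inv_cancel₀ hN, one_mul]

/-! ## §4  The dictionary of the three terms of (26) -/

variable [Fact (0 < (F.L : ℝ))] [Fact (0 < (F.P K).eta k)] [Fact (0 < c0Rec F K k)]
  (ι : Space115Lit F N K k Ω U₀ ≃ₗ[ℂ] BondL2K ℂ (F.P K).d (fun _ => (F.P K).sitesPerDir 0) (c0Rec F K k) (WRec N))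
  (hι : ∀ y, ι y = (funEquiv (phiRec N) (fun _ : B9SectCLatticeCarrier.Bond (F.P K).d (fun _ => (F.P K).sitesPerDir 0) => c0Rec F K k)).symm
    (JetSup.equiv _ _ (nabla115 ((F.P K).eta k) (unitsOfRecord F N U₀)) y))

omit [NeZero N] [Fact (0 < c0Rec F K k)] in
/-- ★ **THE `J`-TERM**: `pair27 τRec J_rec δ = ⟨δ, J⟩` — def-Y's current letter paired by lit's (27)-pairing IS pv27's `bondPair` with r08's `J` at lit's letters of the record
(✓`pair27_Jcur`, def-Y ✓`JOfRecordAtBg_eq`). [cite: Balaban1985Variational, (27)–(28) p.282] -/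
theorem pair27_JOfRecordAtBg_eq_bondPair (δ : B9SectCLatticeCarrier.Bond (F.P K).d (fun _ => (F.P K).sitesPerDir 0) → Matrix (Fin N) (Fin N) ℂ) :
    pair27 (tauRecCLM N) (JOfRecordAtBg F N K k Ω U₀) δ =
      bondPair ((F.P K).eta k) (F.P K).d (tauRec N) (curL δ) (J Tsh (Ucur (unitsOfRecord F N U₀)) ((F.P K).eta k)) := by
  rw [JOfRecordAtBg_eq]
  exact pair27_Jcur (tauRecCLM N) (tauRecCLM_mul_comm N) (unitsOfRecord F N U₀) δ

include hι in
omit [NeZero N] [Fact (0 < (F.L : ℝ))] [Fact (0 < (F.P K).eta k)] [Fact (0 < c0Rec F K k)] in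
/-- The canonical reading, read back: `toAlg φ (ι Y) = Ŷ`. [cite: Balaban1985BackgroundPropagators, (3.11) p.392 (bookkeeping)] -/
theorem toAlg_iota (Y : Space115Lit F N K k Ω U₀) :
    toAlg (phiRec N) (ι Y) = JetSup.equiv _ _ (nabla115 ((F.P K).eta k) (unitsOfRecord F N U₀)) Y := by
  rw [hι]
  exact LinearEquiv.apply_symm_apply _ _

include hι in
omit [NeZero N] [Fact (0 < (F.L : ℝ))] [Fact (0 < (F.P K).eta k)] in
/-- ★★ **THE HESSIAN TERM, POLAR**: for a Hermitian-presented jet `Y` and any `Y′`, `⟪ιY, Δ(U₀) ιY′⟫_ℂ = hessForm tr η U₀ Ŷ Ŷ′` — def-Y's `hessOpOfRecord` (lit (3.10) `hessOp`) read through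
lit's trace pairing (✓`inner_eq_tpair_starW`, ✓`tpair_hessOp_eq` with `hτ₂` = cyclicity of `tr`, `hφ` = ✓`inner_phiRec_symm`, `hU` = `U₀(b)* = U₀(b)⁻¹`, `hc₀` = `c₀ = η^d` by definition of `c0Rec`).
[cite: Balaban1985BackgroundPropagators, (3.10)–(3.11) p.392] -/
theorem inner_iota_hessOpOfRecord_eq_hessForm {Y : Space115Lit F N K k Ω U₀}
    (hY : ∀ b, star (JetSup.equiv _ _ (nabla115 ((F.P K).eta k) (unitsOfRecord F N U₀)) Y b) = JetSup.equiv _ _ (nabla115 ((F.P K).eta k) (unitsOfRecord F N U₀)) Y b)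
    (Y' : Space115Lit F N K k Ω U₀) :
    ⟪ι Y, hessOpOfRecord F N k U₀ (ι Y')⟫_ℂ =
      hessForm (tauRec N) ((F.P K).eta k) (unitsOfRecord F N U₀) (JetSup.equiv _ _ (nabla115 ((F.P K).eta k) (unitsOfRecord F N U₀)) Y)
        (JetSup.equiv _ _ (nabla115 ((F.P K).eta k) (unitsOfRecord F N U₀)) Y') := by
  have hU : ∀ b, star (unitsOfRecord F N U₀ b : Matrix (Fin N) (Fin N) ℂ) = ((unitsOfRecord F N U₀ b)⁻¹ : (Matrix (Fin N) (Fin N) ℂ)ˣ) := fun b => by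
    rw [coe_unitsOfRecord_inv, coe_unitsOfRecord]
  have hc₀ : c0Rec F K k = (F.P K).eta k ^ (F.P K).d := rfl
  have hstar : star (JetSup.equiv _ _ (nabla115 ((F.P K).eta k) (unitsOfRecord F N U₀)) Y) = JetSup.equiv _ _ (nabla115 ((F.P K).eta k) (unitsOfRecord F N U₀)) Y :=
    funext hY
  rw [inner_eq_tpair_starW (phiRec N) (tauRec N) inner_phiRec_symm, hessOpOfRecord,
    tpair_hessOp_eq (phiRec N) (tauRec N) (fun X Y => Matrix.trace_mul_comm X Y) inner_phiRec_symm ((F.P K).eta k) hU hc₀, toAlg_starW,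
    toAlg_iota F N k Ω U₀ ι hι, toAlg_iota F N k Ω U₀ ι hι, hstar]

include hι in
omit [NeZero N] [Fact (0 < (F.L : ℝ))] [Fact (0 < (F.P K).eta k)] in
/-- ★★ **THE HESSIAN TERM OF (26)**: `⟪ιY, Δ(U₀) ιY⟫_ℂ = ⟨Ŷ, ΔŶ⟩ = hessPair Tsh (Ucur U₀) η d tr (curL Ŷ)` (✓`hessForm_self_eq_hessPair`). [cite: Balaban1985BackgroundPropagators, (3.10) p.392; Balaban1985Variational, (26) p.282] -/
theorem inner_iota_hessOpOfRecord_self_eq_hessPair {Y : Space115Lit F N K k Ω U₀}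
    (hY : ∀ b, star (JetSup.equiv _ _ (nabla115 ((F.P K).eta k) (unitsOfRecord F N U₀)) Y b) = JetSup.equiv _ _ (nabla115 ((F.P K).eta k) (unitsOfRecord F N U₀)) Y b) :
    ⟪ι Y, hessOpOfRecord F N k U₀ (ι Y)⟫_ℂ =
      hessPair Tsh (Ucur (unitsOfRecord F N U₀)) ((F.P K).eta k) (F.P K).d (tauRec N) (curL (JetSup.equiv _ _ (nabla115 ((F.P K).eta k) (unitsOfRecord F N U₀)) Y)) := by
  rw [inner_iota_hessOpOfRecord_eq_hessForm F N k Ω U₀ ι hι hY, hessForm_self_eq_hessPair (tauRec N) (fun X Y => Matrix.trace_mul_comm X Y)]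
  rfl

/-! ## §5  (26) at the record in def-Y's letters, modulo the chart letter -/

include hι in
/-- ★★★ **(26) ∕ (74)-without-`π` AT THE RECORD.**  Let `Y` be a Hermitian-presented jet and `U` an `SU(N)`-field whose lit transporters are the `exp(iη·Ŷ)`-perturbation of the
background's: `Ucur (unitsOfRecord F N U) = prodCfg (Ucur (unitsOfRecord F N U₀)) η (curL Ŷ)` (the displayed chart letter — for def-Y's `S.chartLin T♭ V (A′ − 𝔄V)` it is spec (S1) with
`Y := T47 A′`).  THEN `A^η(U) = A^η(U₀) + N⁻¹·ℜ( pair27 τRec J_rec Ŷ + ½⟪ιY, Δ(U₀) ιY⟫_ℂ + V₀(curL Ŷ) )`, `V₀ = V0 Tsh (Ucur (unitsOfRecord F N U₀)) η d tr` — the fourth term of lit's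
`V80`∕`V80Z` at EXACTLY the record's slots.  (pv27 ✓`eq26` is a tautology defining `V₀`; the content is §3–§4's dictionary.) [cite: Balaban1985Variational, (26)–(27) p.282, (74) p.289] -/
theorem wilsonAction4_eq26_atRecordLetters {Y : Space115Lit F N K k Ω U₀}
    (hY : ∀ b, star (JetSup.equiv _ _ (nabla115 ((F.P K).eta k) (unitsOfRecord F N U₀)) Y b) = JetSup.equiv _ _ (nabla115 ((F.P K).eta k) (unitsOfRecord F N U₀)) Y b)
    {U : GaugeField (F.P K) 0 (SU N)}
    (hchart : Ucur (unitsOfRecord F N U) =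
      prodCfg (Ucur (unitsOfRecord F N U₀)) ((F.P K).eta k) (curL (JetSup.equiv _ _ (nabla115 ((F.P K).eta k) (unitsOfRecord F N U₀)) Y))) :
    wilsonAction4 U = wilsonAction4 U₀ + (N : ℝ)⁻¹ * RCLike.re
      (pair27 (tauRecCLM N) (JOfRecordAtBg F N K k Ω U₀) (JetSup.equiv _ _ (nabla115 ((F.P K).eta k) (unitsOfRecord F N U₀)) Y)
        + 2⁻¹ * ⟪ι Y, hessOpOfRecord F N k U₀ (ι Y)⟫_ℂ
        + V0 Tsh (Ucur (unitsOfRecord F N U₀)) ((F.P K).eta k) (F.P K).d (tauRec N)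
            (curL (JetSup.equiv _ _ (nabla115 ((F.P K).eta k) (unitsOfRecord F N U₀)) Y))) := by
  have hN : (N : ℝ) ≠ 0 := Nat.cast_ne_zero.2 (NeZero.ne N)
  have h26 := B11Eq26ActionExpansion.eq26 Tsh (Ucur (unitsOfRecord F N U₀)) ((F.P K).eta k) (F.P K).d (tauRec N)
    (curL (JetSup.equiv _ _ (nabla115 ((F.P K).eta k) (unitsOfRecord F N U₀)) Y))
  rw [← hchart, action_lit_tauRec, action_lit_tauRec, ← pair27_JOfRecordAtBg_eq_bondPair F N k Ω U₀,
    ← inner_iota_hessOpOfRecord_self_eq_hessPair F N k Ω U₀ ι hι hY] at h26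
  have h2 : ((2⁻¹ : ℂ) * ⟪ι Y, hessOpOfRecord F N k U₀ (ι Y)⟫_ℂ).re = 2⁻¹ * (⟪ι Y, hessOpOfRecord F N k U₀ (ι Y)⟫_ℂ).re := by
    rw [show (2⁻¹ : ℂ) = ((2⁻¹ : ℝ) : ℂ) by push_cast; ring, Complex.re_ofReal_mul]
  have hNre : ∀ x : ℝ, ((N : ℂ) * (x : ℂ)).re = N * x := fun x => by
    rw [← Complex.ofReal_natCast, ← Complex.ofReal_mul, Complex.ofReal_re]
  have h := congrArg Complex.re h26
  simp only [Complex.add_re, hNre, h2] at h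
  simp only [RCLike.re_to_complex, Complex.add_re, h2]
  apply mul_left_cancel₀ hN
  rw [mul_add, ← mul_assoc, mul_inv_cancel₀ hN, one_mul]
  linarith [h]

end Record

end Summit.QuantumFields.YangMills.Theorems.N07Eq26TermsAtRecordLetters

end
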